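import Summits.Parity.GeneralizedHardyLittlewood.Theorems.PrimeLevelFamEdgeMomentsBeyondDiagonalFirstOrderOrderJ
import Summits.Parity.GeneralizedHardyLittlewood.Theorems.PrimeLevelFamEdgeMomentsBeyondDiagonalFirstOrderDictionary
import Summits.Parity.GeneralizedHardyLittlewood.Theorems.PrimeLevelFamEdgeMomentsBeyondDiagonalTwoOrderIdentification
import Summits.Parity.GeneralizedHardyLittlewood.Theorems.PrimeLevelFamEdgeMomentsBeyondDiagonalDictionaryAtOneBounds
import Summits.Parity.GeneralizedHardyLittlewood.Theorems.PrimeLevelFamEdgeIdeaDeltasPairsSplit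
import HarnessLib

/-!
# `stub_first : SubFirst` — the FIRST KMV display beyond the diagonal at EVERY order `Q` (window `(1, 3/2]`, `T₁ = 0`)
# (registered stub of line «petersson_layers» v4 of crux K_A `PrimeLevelFamEdge.MomentsBeyondDiagonal`, stmt-Parity-20007)

For every admissible `P`, every real `Q` (even/odd not used), every `Δ' ∈ (1, 3/2]`:
`‖L^h(P,Q)(q̂^{Δ'}) − ζ(2)·√q̂/(Δ' log q̂)·linForm Δ' P Q‖ ≤ C √q̂ (log q̂)⁻²` for all primes `q ≥ 400`:
`L^h(P,Q) = Σ_j Q_j ℓ^{−j} Σʰ Λ^{(j)} M_P` (`LhPQ_eq_sum_orders`), each order from `orderJ_mul_sq_log_sub_le` (order-`j` Bettin by the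
unbalanced split + the order-`j` diagonal main term), the off-diagonal error `q̂^{1/2}·q̂^{Δ'−2}·polylog` absorbed into `√q̂ ℓ^{−2}`
(`Δ' ≤ 3/2`), and `Σ_j Q_j(P′(1)/Δ' + jP(1)) = linForm/Δ'`. Hence `SubFirst` with `Δ = 3/2`, `T₁ = 0`.
This closes the SATELLITE stub `stub_first` of the line; the wall (`stub_rung`/`stub_core`/`stub_band`) is untouched; K_A / K_B / Parity
are NOT proved; nothing about Landau–Siegel zeros.
-/

noncomputable section

open scoped Real
open Set MeasureTheory Finset Polynomial
open Literature.NumberTheory.EllipticCurves.ModularForms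
open Literature.NumberTheory.LFunctions Literature.NumberTheory.LFunctions.KMV2000

namespace Summit.Parity.GeneralizedHardyLittlewood.Theorems.MomentsBeyondDiagonal.FirstOrderAFE

open Summit.Parity.GeneralizedHardyLittlewood.Theorems.PrimeLevelFamEdgeIdeaDeltas.PairsSplit (FirstMomentBeyond SubFirst)

/-- `Σ_j Q_j (P′(1)/Δ' + j P(1)) = linForm Δ' P Q / Δ'`. -/
theorem sum_coeff_mul_main_eq (P Q : ℝ[X]) {Δ' : ℝ} (hΔ : Δ' ≠ 0) :
    ∑ j ∈ range (Q.natDegree + 1), Q.coeff j * ((derivative P).eval 1 / Δ' + (j : ℝ) * P.eval 1) =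
      KMV2000.linForm Δ' P Q / Δ' := by
  have hQ1 : Q.eval 1 = ∑ j ∈ range (Q.natDegree + 1), Q.coeff j := by
    rw [Polynomial.eval_eq_sum_range]; simp
  have hQ'1 : (derivative Q).eval 1 = ∑ j ∈ range (Q.natDegree + 1), Q.coeff j * (j : ℝ) := by
    rw [Polynomial.derivative_eval, Polynomial.sum_over_range' _ _ (Q.natDegree + 1) (Nat.lt_succ_self _)]
    · simp
    · intro n; simp
  rw [KMV2000.linForm, hQ1, hQ'1, eq_div_iff hΔ]
  simp only [Finset.sum_mul, Finset.mul_sum]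
  rw [← Finset.sum_add_distrib]
  exact Finset.sum_congr rfl fun j _ ↦ by field_simp

/-- `q ≥ 400 ⇒ q̂ ≥ 3`. -/
theorem three_le_qhat {q : ℕ} (hq : 400 ≤ q) : 3 ≤ KMV2000.qhat q := by
  have hq' : (400 : ℝ) ≤ q := by exact_mod_cast hq
  have hs : (20 : ℝ) ≤ Real.sqrt q := by
    rw [show (20 : ℝ) = Real.sqrt (20 ^ 2) by rw [Real.sqrt_sq (by norm_num)]]
    exact Real.sqrt_le_sqrt (by norm_num; linarith)
  unfold KMV2000.qhat
  rw [le_div_iff₀ (by positivity)]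
  nlinarith [Real.pi_lt_d2]

set_option maxHeartbeats 800000 in
/-- **The first KMV display beyond the diagonal, every `Q`, window `(1, 3/2]`, no extra main term** (`T₁ = 0`):
for admissible `P`, any real `Q`, `Δ' ∈ (1, 3/2]` there is `C` with
`‖L^h(P,Q)(q̂^{Δ'}) − ζ(2)·√q̂/(Δ' log q̂)·linForm Δ' P Q‖ ≤ C √q̂ (log q̂)⁻²` for all primes `q ≥ 400`.
[cite: KowalskiMichelVanderKam2000, Prop. 4.1 and §6 (30)] [cite: Bettin2017, Thm. 1.1] -/
theorem firstDisplay_allQ {P : ℝ[X]} (hP : Admissible P) (Q : ℝ[X]) {Δ' : ℝ} (h1 : 1 < Δ') (h2 : Δ' ≤ 3 / 2) :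
    ∃ C : ℝ, ∀ (q : ℕ) [NeZero q], q.Prime → 400 ≤ q →
      ‖LhPQ q P Q (KMV2000.qhat q ^ Δ') -
          (riemannZeta 2 * ((Real.sqrt (KMV2000.qhat q) / (Δ' * Real.log (KMV2000.qhat q)) : ℝ) : ℂ)) *
            ((KMV2000.linForm Δ' P Q : ℝ) : ℂ)‖ ≤
        C * Real.sqrt (KMV2000.qhat q) * (Real.log (KMV2000.qhat q))⁻¹ ^ 2 := by
  classical
  have hΔ0 : 0 < Δ' := by linarith
  -- per-order constants
  have hO : ∀ j : ℕ, ∃ C₁ C₂ : ℝ, 0 ≤ C₁ ∧ 0 ≤ C₂ ∧ ∀ (N : ℕ) [NeZero N], N.Prime → ∀ B : ℝ,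
      (∀ t ∈ Set.Icc (0 : ℝ) 1, |P.eval t| ≤ B) →
      1 ≤ Real.log (KMV2000.qhat N) → 3 ≤ KMV2000.qhat N ^ Δ' → KMV2000.qhat N ^ Δ' ≤ N →
      ‖(((Real.log (KMV2000.qhat N)) ^ 2 : ℝ) : ℂ) *
            GL2Family.harmonicSum N 2 (fun f ↦ derivLambda N j f * mollifierP N P (KMV2000.qhat N ^ Δ') f) -
          ((KMV2000.qhat N : ℝ) : ℂ) ^ (1 / 2 : ℂ) *
            ((π ^ 2 / 6 * Real.log (KMV2000.qhat N) ^ (j + 1) * ((derivative P).eval 1 / Δ' + (j : ℝ) * P.eval 1) : ℝ) : ℂ)‖ ≤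
        C₁ * (1 + Real.log N) ^ (j + 4) * Real.sqrt (KMV2000.qhat N) * B * KMV2000.qhat N ^ Δ' *
            Real.log (KMV2000.qhat N) ^ 2 / N +
          C₂ * Real.sqrt (KMV2000.qhat N) * Real.log (KMV2000.qhat N) ^ j :=
    fun j ↦ orderJ_mul_sq_log_sub_le hP hΔ0 j
  choose C₁ C₂ hC₁0 hC₂0 hO using hO
  set B : ℝ := ∑ i ∈ range (P.natDegree + 1), |P.coeff i| with hBdef
  have hB : ∀ t ∈ Set.Icc (0 : ℝ) 1, |P.eval t| ≤ B := fun t ht ↦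
    PrimeLevelFamEdgeIdeaDeltas.PeterssonLayers.abs_eval_le_sum_abs_coeff P ht
  have hB0 : 0 ≤ B := Finset.sum_nonneg fun i _ ↦ abs_nonneg _
  -- the absorption constant for order `j`: `C₁ B 9^{j+4} (1+ℓ)^{j+4} ℓ² q̂^{Δ'}/q ≤ K_j`
  set K : ℕ → ℝ := fun j ↦ C₁ j * B * 9 ^ (j + 4) * (2 ^ (j + 6) * ((j + 6).factorial : ℝ)) * 2 ^ (j + 6) with hKdef
  refine ⟨∑ j ∈ range (Q.natDegree + 1), |Q.coeff j| * (K j + C₂ j), fun q _ hq hq400 ↦ ?_⟩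
  -- sizes at level q
  set qh : ℝ := KMV2000.qhat q with hqh
  have hqh3 : 3 ≤ qh := three_le_qhat hq400
  have hqh1 : 1 ≤ qh := by linarith
  have hqh0 : 0 < qh := by linarith
  set ℓ : ℝ := Real.log qh with hℓdef
  have hℓ1 : 1 ≤ ℓ := by
    rw [hℓdef, ← Real.log_exp 1]
    exact Real.log_le_log (Real.exp_pos 1) (TwoOrderAFE.exp_one_le_qhat (by omega))
  have hℓ0 : 0 < ℓ := by linarith
  set M : ℝ := qh ^ Δ' with hMdef
  have hM3 : 3 ≤ M := hqh3.trans (by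
    rw [hMdef]; exact Real.self_le_rpow_of_one_le hqh1 h1.le)
  have hq64 : 64 ≤ q := by omega
  have hqR : (q : ℝ) = 4 * π ^ 2 * qh ^ 2 := by
    rw [hqh, qhat_sq]; field_simp
  have hq0 : (0 : ℝ) < q := by exact_mod_cast hq.pos
  have hπ2 : (1 : ℝ) ≤ 4 * π ^ 2 := by nlinarith [Real.pi_gt_three]
  have hMq : M ≤ q := by
    have hM2 : M ≤ qh ^ (2 : ℝ) := Real.rpow_le_rpow_of_exponent_le hqh1 (by linarith)
    rw [Real.rpow_two] at hM2
    rw [hqR]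
    calc M ≤ qh ^ 2 := hM2
      _ = 1 * qh ^ 2 := by ring
      _ ≤ 4 * π ^ 2 * qh ^ 2 := by gcongr
  have hlogq : 1 + Real.log (q : ℝ) ≤ 9 * (1 + ℓ) := by
    have := TwoOrderAFE.one_add_two_log_le (q := q) hq64
    have hlq : 0 ≤ Real.log (q : ℝ) := Real.log_nonneg (by exact_mod_cast hq.one_lt.le)
    linarith
  -- absorption: `(1 + log q)^{j+4} ℓ² q̂^{Δ'} / q ≤ 9^{j+4} 2^{j+6} (j+6)! 2^{j+6} · 1/(4π²) · … ≤ K_j/(C₁ B)`; we prove directly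
  have habs : ∀ j : ℕ, C₁ j * (1 + Real.log q) ^ (j + 4) * Real.sqrt qh * B * M * ℓ ^ 2 / q ≤ K j * Real.sqrt qh := by
    intro j
    have h1l : (1 + Real.log (q : ℝ)) ^ (j + 4) ≤ 9 ^ (j + 4) * (1 + ℓ) ^ (j + 4) := by
      rw [← mul_pow]; exact pow_le_pow_left₀ (by linarith [Real.log_nonneg (by exact_mod_cast hq.one_lt.le : (1:ℝ) ≤ q)]) hlogq _
    have h2l : (1 + ℓ) ^ (j + 4) * ℓ ^ 2 ≤ (2 * ℓ) ^ (j + 6) := by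
      rw [pow_add (2 * ℓ) (j + 4) 2, mul_pow]
      have : (1 + ℓ) ^ (j + 4) ≤ (2 * ℓ) ^ (j + 4) := pow_le_pow_left₀ (by linarith) (by linarith) _
      have h22 : ℓ ^ 2 ≤ 2 ^ 2 * ℓ ^ 2 := by nlinarith [sq_nonneg ℓ]
      calc (1 + ℓ) ^ (j + 4) * ℓ ^ 2 ≤ (2 * ℓ) ^ (j + 4) * (2 ^ 2 * ℓ ^ 2) := by gcongr
        _ = _ := by ring
    have h3l : ℓ ^ (j + 6) ≤ 2 ^ (j + 6) * ((j + 6).factorial : ℝ) * Real.exp (ℓ / 2) := by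
      have h := Real.pow_div_factorial_le_exp (x := ℓ / 2) (by positivity) (j + 6)
      rw [div_pow, div_le_iff₀ (by positivity)] at h
      calc ℓ ^ (j + 6) = (ℓ ^ (j + 6) / 2 ^ (j + 6)) * 2 ^ (j + 6) := by field_simp
        _ ≤ (Real.exp (ℓ / 2) * (j + 6).factorial) * 2 ^ (j + 6) := by gcongr
        _ = _ := by ring
    have hexp : Real.exp (ℓ / 2) = Real.sqrt qh := by
      rw [hℓdef, Real.sqrt_eq_rpow, Real.rpow_def_of_pos hqh0]; ring_nf
    -- `M/q ≤ qh^{3/2}/(4π² qh²) ≤ 1/(qh^{1/2})`: we use `M ≤ qh^{3/2}` and `q = 4π²qh²`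
    have hM32 : M ≤ qh ^ (3 / 2 : ℝ) := Real.rpow_le_rpow_of_exponent_le hqh1 h2
    have hq32 : qh ^ (3 / 2 : ℝ) = qh * Real.sqrt qh := by
      rw [Real.sqrt_eq_rpow, show (3 / 2 : ℝ) = 1 + 1 / 2 by norm_num, Real.rpow_add hqh0, Real.rpow_one]
    have hsq : Real.sqrt qh * Real.sqrt qh = qh := Real.mul_self_sqrt hqh0.le
    have hsq0 : 0 < Real.sqrt qh := Real.sqrt_pos.mpr hqh0
    -- main chain
    have hnum : C₁ j * (1 + Real.log q) ^ (j + 4) * Real.sqrt qh * B * M * ℓ ^ 2 ≤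
        C₁ j * B * 9 ^ (j + 4) * (2 ^ (j + 6) * ((j + 6).factorial : ℝ)) * 2 ^ (j + 6) * (Real.sqrt qh * Real.sqrt qh * M) := by
      have step1 : (1 + Real.log (q : ℝ)) ^ (j + 4) * ℓ ^ 2 ≤ 9 ^ (j + 4) * (2 * ℓ) ^ (j + 6) := by
        calc (1 + Real.log (q : ℝ)) ^ (j + 4) * ℓ ^ 2 ≤ 9 ^ (j + 4) * (1 + ℓ) ^ (j + 4) * ℓ ^ 2 := by gcongr
          _ = 9 ^ (j + 4) * ((1 + ℓ) ^ (j + 4) * ℓ ^ 2) := by ring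
          _ ≤ 9 ^ (j + 4) * (2 * ℓ) ^ (j + 6) := by gcongr
      have step2 : (2 * ℓ) ^ (j + 6) ≤ 2 ^ (j + 6) * (2 ^ (j + 6) * ((j + 6).factorial : ℝ) * Real.sqrt qh) := by
        rw [mul_pow, ← hexp]; gcongr
      have step12 : (1 + Real.log (q : ℝ)) ^ (j + 4) * ℓ ^ 2 ≤
          9 ^ (j + 4) * (2 ^ (j + 6) * (2 ^ (j + 6) * ((j + 6).factorial : ℝ) * Real.sqrt qh)) :=
        step1.trans (mul_le_mul_of_nonneg_left step2 (by positivity))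
      have hM0 : 0 ≤ M := by linarith
      calc C₁ j * (1 + Real.log q) ^ (j + 4) * Real.sqrt qh * B * M * ℓ ^ 2
          = C₁ j * B * Real.sqrt qh * M * ((1 + Real.log (q : ℝ)) ^ (j + 4) * ℓ ^ 2) := by ring
        _ ≤ C₁ j * B * Real.sqrt qh * M * (9 ^ (j + 4) * (2 ^ (j + 6) * (2 ^ (j + 6) * ((j + 6).factorial : ℝ) * Real.sqrt qh))) :=
            mul_le_mul_of_nonneg_left step12 (mul_nonneg (mul_nonneg (mul_nonneg (hC₁0 j) hB0) (Real.sqrt_nonneg _)) hM0)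
        _ = _ := by ring
    rw [div_le_iff₀ hq0]
    refine hnum.trans ?_
    rw [hKdef]
    simp only
    have hMq' : Real.sqrt qh * Real.sqrt qh * M ≤ Real.sqrt qh * q := by
      rw [hqR, hsq]
      calc qh * M ≤ qh * (qh * Real.sqrt qh) := by rw [← hq32]; exact mul_le_mul_of_nonneg_left hM32 hqh0.le
        _ = 1 * (qh ^ 2 * Real.sqrt qh) := by ring
        _ ≤ (4 * π ^ 2) * (qh ^ 2 * Real.sqrt qh) := by gcongr
        _ = Real.sqrt qh * (4 * π ^ 2 * qh ^ 2) := by ring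
    have hc0 : 0 ≤ C₁ j * B * 9 ^ (j + 4) * (2 ^ (j + 6) * ((j + 6).factorial : ℝ)) * 2 ^ (j + 6) := by
      have := hC₁0 j; positivity
    calc C₁ j * B * 9 ^ (j + 4) * (2 ^ (j + 6) * ((j + 6).factorial : ℝ)) * 2 ^ (j + 6) * (Real.sqrt qh * Real.sqrt qh * M)
        ≤ C₁ j * B * 9 ^ (j + 4) * (2 ^ (j + 6) * ((j + 6).factorial : ℝ)) * 2 ^ (j + 6) * (Real.sqrt qh * q) :=
          mul_le_mul_of_nonneg_left hMq' hc0
      _ = _ := by ring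
  -- per order: `‖Q_j ℓ^{-j} S_j − Q_j √q̂ ζ2 ℓ^{-1} c_j‖ ≤ |Q_j| (K_j + C₂ j) √q̂ ℓ^{-2}`
  have hnq : ((qh : ℝ) : ℂ) ^ (1 / 2 : ℂ) = ((Real.sqrt qh : ℝ) : ℂ) := by
    rw [Real.sqrt_eq_rpow, Complex.ofReal_cpow hqh0.le]; norm_num
  have hζ : riemannZeta 2 = ((π ^ 2 / 6 : ℝ) : ℂ) := by rw [riemannZeta_two]; push_cast; ring
  have hord : ∀ j ∈ range (Q.natDegree + 1),
      ‖(Q.coeff j : ℂ) * (((ℓ⁻¹ : ℝ) : ℂ)) ^ j *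
          GL2Family.harmonicSum q 2 (fun f ↦ derivLambda q j f * mollifierP q P M f) -
        (Q.coeff j : ℂ) * ((Real.sqrt qh * (π ^ 2 / 6) * ℓ⁻¹ * ((derivative P).eval 1 / Δ' + (j : ℝ) * P.eval 1) : ℝ) : ℂ)‖ ≤
        |Q.coeff j| * (K j + C₂ j) * (Real.sqrt qh * ℓ⁻¹ ^ 2) := by
    intro j _
    have hS := hO j q hq B hB hℓ1 hM3 hMq
    rw [hnq] at hS
    set S := GL2Family.harmonicSum q 2 (fun f ↦ derivLambda q j f * mollifierP q P M f) with hSdef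
    -- factor `Q_j ℓ^{-j-2}` out
    have hℓne : ℓ ≠ 0 := hℓ0.ne'
    have hℓC : (ℓ : ℂ) ≠ 0 := by exact_mod_cast hℓne
    have hΔC : (Δ' : ℂ) ≠ 0 := by exact_mod_cast hΔ0.ne'
    have hfac : (Q.coeff j : ℂ) * (((ℓ⁻¹ : ℝ) : ℂ)) ^ j * S -
        (Q.coeff j : ℂ) * ((Real.sqrt qh * (π ^ 2 / 6) * ℓ⁻¹ * ((derivative P).eval 1 / Δ' + (j : ℝ) * P.eval 1) : ℝ) : ℂ) =
        ((Q.coeff j / ℓ ^ (j + 2) : ℝ) : ℂ) * ((((ℓ ^ 2 : ℝ)) : ℂ) * S -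
          ((Real.sqrt qh : ℝ) : ℂ) * ((π ^ 2 / 6 * ℓ ^ (j + 1) * ((derivative P).eval 1 / Δ' + (j : ℝ) * P.eval 1) : ℝ) : ℂ)) := by
      push_cast
      rw [inv_pow]
      field_simp
      ring
    rw [hfac, norm_mul, Complex.norm_real, Real.norm_eq_abs, abs_div, abs_of_pos (pow_pos hℓ0 _), div_eq_mul_inv, ← inv_pow]
    calc |Q.coeff j| * ℓ⁻¹ ^ (j + 2) * ‖(((ℓ ^ 2 : ℝ)) : ℂ) * S -
          ((Real.sqrt qh : ℝ) : ℂ) * ((π ^ 2 / 6 * ℓ ^ (j + 1) * ((derivative P).eval 1 / Δ' + (j : ℝ) * P.eval 1) : ℝ) : ℂ)‖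
        ≤ |Q.coeff j| * ℓ⁻¹ ^ (j + 2) * (K j * Real.sqrt qh + C₂ j * Real.sqrt qh * ℓ ^ j) := by
          gcongr
          exact hS.trans (add_le_add (habs j) le_rfl)
      _ = |Q.coeff j| * (Real.sqrt qh * ℓ⁻¹ ^ 2) * (K j * ℓ⁻¹ ^ j + C₂ j * (ℓ⁻¹ ^ j * ℓ ^ j)) := by ring
      _ ≤ |Q.coeff j| * (Real.sqrt qh * ℓ⁻¹ ^ 2) * (K j * 1 + C₂ j * 1) := by
          have hK0 : 0 ≤ K j := by rw [hKdef]; have := hC₁0 j; positivity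
          have hi1 : ℓ⁻¹ ^ j ≤ 1 := pow_le_one₀ (by positivity) (inv_le_one_of_one_le₀ hℓ1)
          have hi2 : ℓ⁻¹ ^ j * ℓ ^ j = 1 := by rw [← mul_pow, inv_mul_cancel₀ hℓne, one_pow]
          rw [hi2]
          gcongr
      _ = |Q.coeff j| * (K j + C₂ j) * (Real.sqrt qh * ℓ⁻¹ ^ 2) := by ring
  -- assemble over the orders
  rw [LhPQ_eq_sum_orders, hζ]
  have hℓne' : ℓ ≠ 0 := hℓ0.ne'
  have hmainR : (π ^ 2 / 6) * (Real.sqrt qh / (Δ' * ℓ)) * KMV2000.linForm Δ' P Q =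
      ∑ j ∈ range (Q.natDegree + 1),
        Q.coeff j * (Real.sqrt qh * (π ^ 2 / 6) * ℓ⁻¹ * ((derivative P).eval 1 / Δ' + (j : ℝ) * P.eval 1)) := by
    have h := sum_coeff_mul_main_eq P Q hΔ0.ne'
    have h' : KMV2000.linForm Δ' P Q = Δ' * ∑ j ∈ range (Q.natDegree + 1),
        Q.coeff j * ((derivative P).eval 1 / Δ' + (j : ℝ) * P.eval 1) := by rw [h]; field_simp
    rw [h', Finset.mul_sum, Finset.mul_sum]
    refine Finset.sum_congr rfl fun j _ ↦ ?_
    field_simp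
  have hmain : ((π ^ 2 / 6 : ℝ) : ℂ) * ((Real.sqrt qh / (Δ' * ℓ) : ℝ) : ℂ) * ((KMV2000.linForm Δ' P Q : ℝ) : ℂ) =
      ∑ j ∈ range (Q.natDegree + 1),
        (Q.coeff j : ℂ) * ((Real.sqrt qh * (π ^ 2 / 6) * ℓ⁻¹ * ((derivative P).eval 1 / Δ' + (j : ℝ) * P.eval 1) : ℝ) : ℂ) := by
    have hc := congrArg (fun x : ℝ ↦ (x : ℂ)) hmainR
    push_cast at hc ⊢
    linear_combination hc
  rw [hmain, ← Finset.sum_sub_distrib]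
  refine (norm_sum_le _ _).trans ?_
  calc ∑ j ∈ range (Q.natDegree + 1), ‖(Q.coeff j : ℂ) * (((ℓ⁻¹ : ℝ) : ℂ)) ^ j *
          GL2Family.harmonicSum q 2 (fun f ↦ derivLambda q j f * mollifierP q P M f) -
        (Q.coeff j : ℂ) * ((Real.sqrt qh * (π ^ 2 / 6) * ℓ⁻¹ * ((derivative P).eval 1 / Δ' + (j : ℝ) * P.eval 1) : ℝ) : ℂ)‖
      ≤ ∑ j ∈ range (Q.natDegree + 1), |Q.coeff j| * (K j + C₂ j) * (Real.sqrt qh * ℓ⁻¹ ^ 2) := Finset.sum_le_sum hord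
    _ = (∑ j ∈ range (Q.natDegree + 1), |Q.coeff j| * (K j + C₂ j)) * Real.sqrt qh * ℓ⁻¹ ^ 2 := by
        rw [Finset.sum_mul, Finset.sum_mul]
        exact Finset.sum_congr rfl fun j _ ↦ by ring

/-- **`stub_first : SubFirst`** — the registered satellite stub of line «petersson_layers» v4 (and of the birth /
pairs_beyond_family_size lines): the first display beyond the diagonal holds for EVERY admissible `P` and EVERY `Q` on the window
`(1, 3/2]`, with NO extra main term (`T₁ = 0`). [cite: KowalskiMichelVanderKam2000, Prop. 4.1, §6 (30)] [cite: Bettin2017, Thm. 1.1] -/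
theorem stub_first : SubFirst := by
  refine ⟨3 / 2, by norm_num, fun _ _ _ ↦ 0, ?_⟩
  intro P Q hP _ Δ' h1 h2
  obtain ⟨C, hC⟩ := firstDisplay_allQ hP Q h1 h2
  refine ⟨C, 400, fun q _ hq hq₀ _ ↦ ?_⟩
  have h := hC q hq hq₀
  simpa only [add_zero] using h

end Summit.Parity.GeneralizedHardyLittlewood.Theorems.MomentsBeyondDiagonal.FirstOrderAFE

end
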